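import Summits.QuantumFields.BalabanUV.T4Continuum.Support.SubstrateNestedToriOfRecord

/-!
# SUBSTRATE — THE BONDS OF A CUBE FAMILY ON BAŁABAN's LATTICE, COUNTED: `bondsOfCubes R k W` (level-`k` bonds with both endpoint cubes in a
# family `W` of cubes of `π_k`), row NE5's `bondsIn R Z₀` read through it (at `domEmb` and at the fine-torus embedding `fineEmb` of W-23), and the
# count `#(bondsOfCubes R k W) ≤ 4·(L^{m′})^4·#W` — the owner's `bondsOf`∕`hb₀` of `Spine/NE1p/DressedSmallFieldRecordLabels` ON THE CARRIERS
# OF RECORD with the explicit constant `b₀ = 4·L^{4m′}` (W-23c = LIBRARY L-E17c, typer (ο8-1); follow-on of W-23 = L-E17; [dict] layer, NE1′ F-2 junction)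

Cell `pub-balaban`, SUBSTRATE cell, seat `b2b-balaban-substrate-p1` (gen 6).  Summits-side under the LEAN PLACEMENT RULE (cell bookkeeping).
HONEST FRAMING: rung (B)+1 of the FINITE-VOLUME T⁴ programme — NOT infinite volume, NOT a mass gap, NOT Clay; spine PROVED 0∕9; NE1′ ∕ NE5
NOT PRINTED ∕ NOT PROVED.  HONEST DEPENDENCY (cell line, verbatim): continuum YM on T⁴ ⇐ BetaPertH ∧ nine spine estimates (0/9 proved);
BetaPertH ⇐ (D1) ∧ (D4) ∧ CAP+tail; G-an2-4 gates asym, D1 and NE2/3/4.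

WHY.  The owner's second-step count `count_recordLabels_geometry` (N0y §1) and its ENDs (§2) display `bondsOf : Finset CubeK → Finset Bnd` with
the linear count `hb₀ : ∀ W, #(bondsOf W) ≤ b₀·#W` and the admissibility clause `ℓ.P ⊆ bondsOf (cubes Z₀ ∖ ∪fam)` ([Balaban1988RG2Cluster] p. 12
«P ⊂ Y₀^{c*}», p. 18 «one bond in P may connect two cubes in Z₀∖Y₀» — KIND); on the carriers of record (`CubeK := TPt 4 (L·N′)` via W-23's
`fineEmb`, `Bnd := B13InnerData.Bnd R`) nobody had typed `bondsOf` or counted bonds per cube.  Here: a bond of run A's level-`k` lattice is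
its source site and one of `4` directions (`Setup.PBond`), a cube of `π_k` holds at most `(L^{m′})^4` level-`k` sites (`sitesPerDir k =
L^{m′}·cubesPerDir k` on the standing range `k + m′ ≤ m + K`; the residues with a prescribed quotient inject into a box), so `b₀ = 4·L^{4m′}`.

WHAT (defs `bondsOfCubes`, `bondsOfFineCubes` + theorems; imports W-23 `SubstrateNestedToriOfRecord` ONLY; nothing existing is modified):
§1 `card_filter_val_div_eq_le` (`#{v : ZMod S | v.val ∕ M = t} ≤ M`), `card_filter_pi_val_div_eq_le` (`≤ M^d`); §2 `sitesPerDir_eq_mul_cubesPerDir`,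
`toCube_eq_iff` (the cube of a site coordinatewise: `toCube R k k x = a ↔ ∀ ν, (x ν).val ∕ L^{m′} = (a ν).val`), `card_filter_toCube_eq_le`
(`≤ (L^{m′})^4` sites per cube), `card_filter_toCube_mem_le`; §3 `bondsOfCubes`, `mem_bondsOfCubes_iff`, `bondsOfCubes_mono`, **`bondsIn_domEmb_eq`**
(`bondsIn R (domEmb R k Z₀) = bondsOfCubes R k Z₀.1`), **`card_bondsOfCubes_le`** (`≤ 4·(L^{m′})^4·#W`), `card_bondsOfCubes_le_real`; §4 (the
owner's currency `CubeK := TPt 4 (L·N′)`, `hk : k + 1 + m′ ≤ m + K` as in W-23) `bondsOfFineCubes hk`, `bondsOfFineCubes_mono`, **`bondsIn_fineEmb_eq`**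
(W-23's well-formedness bond clause read torus-side), **`card_bondsOfFineCubes_le`**, **`card_bondsOfFineCubes_le_real`** (`((bondsOfFineCubes hk W).card
: ℝ) ≤ (4·L^{4m′})·W.card` — the `hb₀` shape).  HONEST: lattice combinatorics only; which bond sets the terms carry is the owner's ∕ row NE5's
displayed filter; nothing of (B1b)∕(B3) or of any estimate is discharged; 0 sorry.
-/

noncomputable section

open scoped BigOperators

namespace Summit.QuantumFields.BalabanUV.T4Continuum.SubstrateBondsOfCubes

open Literature.MathematicalPhysics.QuantumFieldTheory.Balaban1983to89
open Literature.MathematicalPhysics.QuantumFieldTheory.Balaban1983to89.TreeLengthTorus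
open Literature.MathematicalPhysics.QuantumFieldTheory.Balaban1983to89.T4Continuum (T4Family)
open Summit.QuantumFields.BalabanUV.T4Continuum.B13Carriers (TwoRuns)
open Summit.QuantumFields.BalabanUV.T4Continuum.B13CarriersFootprint (toCube toCube_apply sitesAt bondsAt mem_sitesAt mem_bondsAt)
open Summit.QuantumFields.BalabanUV.T4Continuum.B13DomainGeometryTR (domEmb domEmb_apply)
open Summit.QuantumFields.BalabanUV.T4Continuum.B13InnerData (Bnd bondsIn mem_bondsIn)
open Summit.QuantumFields.BalabanUV.T4Continuum.SubstrateNestedToriOfRecord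

/-! ## §1 Counting residues with a prescribed quotient -/

section Count

/-- [folklore] **AT MOST `M` RESIDUES PER BLOCK**: the residues `v : ZMod S` with `v.val ∕ M = t` inject by `val` into the window
`[M·t, M·t + M)`, so there are at most `M` of them. -/
theorem card_filter_val_div_eq_le (S : ℕ) [NeZero S] {M : ℕ} (hM : 0 < M) (t : ℕ) (s : Finset (ZMod S)) :
    (s.filter fun v => v.val / M = t).card ≤ M := by
  classical
  calc (s.filter fun v => v.val / M = t).card ≤ (Finset.Ico (M * t) (M * t + M)).card :=
        Finset.card_le_card_of_injOn ZMod.val (fun v hv => ?_) (fun v _ w _ h => ZMod.val_injective S h)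
    _ = M := by simp
  have ht : v.val / M = t := (Finset.mem_filter.1 (Finset.mem_coe.1 hv)).2
  rw [Finset.coe_Ico, Set.mem_Ico]
  constructor
  · have h1 := Nat.div_mul_le_self v.val M
    rw [ht] at h1
    linarith [Nat.mul_comm M t]
  · have h2 := Nat.lt_div_mul_add (a := v.val) hM
    rw [ht] at h2
    linarith [Nat.mul_comm M t]

/-- [folklore] **AT MOST `M^d` INDEX VECTORS PER BLOCK**: the vectors `x : Fin d → ZMod S` with `(x ν).val ∕ M = t ν` for every `ν`
inject by `val` into the box `Π_ν [M·t ν, M·t ν + M)`. -/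
theorem card_filter_pi_val_div_eq_le {d : ℕ} (S : ℕ) [NeZero S] {M : ℕ} (hM : 0 < M) (t : Fin d → ℕ)
    (s : Finset (Fin d → ZMod S)) : (s.filter fun x => ∀ ν, (x ν).val / M = t ν).card ≤ M ^ d := by
  classical
  set B : Finset (Fin d → ℕ) := Fintype.piFinset fun ν => Finset.Ico (M * t ν) (M * t ν + M) with hB
  have hcard : B.card = M ^ d := by
    rw [hB, Fintype.card_piFinset]
    simp
  rw [← hcard]
  refine Finset.card_le_card_of_injOn (fun x ν => (x ν).val) (fun x hx => ?_) (fun x _ x' _ h => ?_)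
  · have hx' : ∀ ν, (x ν).val / M = t ν := (Finset.mem_filter.1 (Finset.mem_coe.1 hx)).2
    rw [Finset.mem_coe, Fintype.mem_piFinset]
    intro ν
    rw [Finset.mem_Ico]
    constructor
    · have h1 := Nat.div_mul_le_self (x ν).val M
      rw [hx' ν] at h1
      linarith [Nat.mul_comm M (t ν)]
    · have h2 := Nat.lt_div_mul_add (a := (x ν).val) hM
      rw [hx' ν] at h2
      linarith [Nat.mul_comm M (t ν)]
  · funext ν
    exact ZMod.val_injective S (congrFun h ν)

end Count

/-! ## §2 Sites per cube on the carriers of record: at most `(L^{m′})^4` -/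

section Sites

variable {G : Type} [GaugeGroup G] (R : TwoRuns G) {k : ℕ}

/-- [folklore] The level-`k` lattice has `L^{m′}` sites per cube side: `sitesPerDir k = L^{m′} · cubesPerDir k` on the standing range
`k + m′ ≤ m + K` (`TreeLengthTorus.sitesPerDir_eq_pow_mul`). -/
theorem sitesPerDir_eq_mul_cubesPerDir (hk : k + R.m' ≤ R.F.m + R.K) :
    (R.F.P R.K).sitesPerDir k = R.F.L ^ R.m' * R.cubesPerDir k := by
  have h := sitesPerDir_eq_pow_mul (R.F.P R.K) (j := k) (k := k + R.m') (by omega)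
    (by simp only [T4Family.P_m, T4Family.P_K]; omega)
  rw [Nat.add_sub_cancel_left, T4Family.P_L] at h
  simpa only [TwoRuns.cubesPerDir] using h

/-- [folklore] **THE CUBE OF A SITE, COORDINATEWISE**: `toCube R k k x = a ↔ ∀ ν, (x ν).val ∕ L^{m′} = (a ν).val` (the quotient is `< cubesPerDir k`,
so the cast into `ZMod (cubesPerDir k)` is faithful). -/
theorem toCube_eq_iff (hk : k + R.m' ≤ R.F.m + R.K) (x : Site (R.F.P R.K) k) (a : TPt 4 (R.cubesPerDir k)) :
    toCube R k k x = a ↔ ∀ ν, (x ν).val / R.F.L ^ R.m' = (a ν).val := by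
  have hM : 0 < R.F.L ^ R.m' := pow_pos (by have := R.F.hL.2; omega) _
  have hlt : ∀ ν, (x ν).val / R.F.L ^ R.m' < R.cubesPerDir k := fun ν => by
    rw [Nat.div_lt_iff_lt_mul hM, mul_comm, ← sitesPerDir_eq_mul_cubesPerDir R hk]
    exact ZMod.val_lt (x ν)
  rw [funext_iff]
  refine forall_congr' fun ν => ?_
  rw [toCube_apply, show k + R.m' - k = R.m' by omega]
  constructor
  · intro h
    rw [← h, ZMod.val_cast_of_lt (hlt ν)]
  · intro h
    rw [h, ZMod.natCast_zmod_val]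

/-- [folklore] **AT MOST `(L^{m′})^4` SITES OF LEVEL `k` PER CUBE OF `π_k`.** -/
theorem card_filter_toCube_eq_le (hk : k + R.m' ≤ R.F.m + R.K) (a : TPt 4 (R.cubesPerDir k)) (s : Finset (Site (R.F.P R.K) k)) :
    (s.filter fun x => toCube R k k x = a).card ≤ (R.F.L ^ R.m') ^ 4 := by
  classical
  have hM : 0 < R.F.L ^ R.m' := pow_pos (by have := R.F.hL.2; omega) _
  have h := card_filter_pi_val_div_eq_le ((R.F.P R.K).sitesPerDir k) hM (fun ν => (a ν).val) s
  refine le_trans (le_of_eq ?_) h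
  congr 1
  exact Finset.filter_congr fun x _ => toCube_eq_iff R hk x a

/-- [folklore] **SITES WITH CUBE IN A FAMILY `W`**: at most `(L^{m′})^4 · #W`. -/
theorem card_filter_toCube_mem_le (hk : k + R.m' ≤ R.F.m + R.K) (W : Finset (TPt 4 (R.cubesPerDir k))) :
    ((Finset.univ : Finset (Site (R.F.P R.K) k)).filter fun x => toCube R k k x ∈ W).card ≤ (R.F.L ^ R.m') ^ 4 * W.card := by
  classical
  have hsub : ((Finset.univ : Finset (Site (R.F.P R.K) k)).filter fun x => toCube R k k x ∈ W) ⊆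
      W.biUnion fun a => (Finset.univ : Finset (Site (R.F.P R.K) k)).filter fun x => toCube R k k x = a := by
    intro x hx
    exact Finset.mem_biUnion.2 ⟨toCube R k k x, (Finset.mem_filter.1 hx).2, Finset.mem_filter.2 ⟨Finset.mem_univ _, rfl⟩⟩
  refine (Finset.card_le_card hsub).trans ((Finset.card_biUnion_le).trans ?_)
  calc ∑ a ∈ W, ((Finset.univ : Finset (Site (R.F.P R.K) k)).filter fun x => toCube R k k x = a).card
      ≤ ∑ _a ∈ W, (R.F.L ^ R.m') ^ 4 := Finset.sum_le_sum fun a _ => card_filter_toCube_eq_le R hk a _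
    _ = (R.F.L ^ R.m') ^ 4 * W.card := by rw [Finset.sum_const, smul_eq_mul, mul_comm]

end Sites

/-! ## §3 The bonds of a cube family at scale `k`; `bondsIn` read through it; the count `≤ 4·L^{4m′}·#W` -/

section Bonds

variable {G : Type} [GaugeGroup G] (R : TwoRuns G) {k : ℕ}

/-- [folklore] **THE LEVEL-`k` BONDS OF A FAMILY `W` OF CUBES OF `π_k`**: the positively oriented bonds of run A's level-`k` lattice whose
source AND target cubes belong to `W`, tagged by their level (an element of the labels' bond type `Bnd R`). -/
noncomputable def bondsOfCubes (k : ℕ) (W : Finset (TPt 4 (R.cubesPerDir k))) : Finset (Bnd R) :=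
  ((Finset.univ : Finset (PBond (R.F.P R.K) k)).filter fun c => toCube R k k c.src ∈ W ∧ toCube R k k c.tgt ∈ W).map
    (Function.Embedding.sigmaMk (β := fun i : ℕ => PBond (R.F.P R.K) i) k)

/-- [folklore] Membership in `bondsOfCubes`. -/
theorem mem_bondsOfCubes_iff {W : Finset (TPt 4 (R.cubesPerDir k))} {b : Bnd R} :
    b ∈ bondsOfCubes R k W ↔ ∃ c : PBond (R.F.P R.K) k, b = ⟨k, c⟩ ∧ toCube R k k c.src ∈ W ∧ toCube R k k c.tgt ∈ W := by
  simp only [bondsOfCubes, Finset.mem_map, Finset.mem_filter, Finset.mem_univ, true_and, Function.Embedding.sigmaMk_apply]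
  constructor
  · rintro ⟨c, ⟨h1, h2⟩, rfl⟩; exact ⟨c, rfl, h1, h2⟩
  · rintro ⟨c, rfl, h1, h2⟩; exact ⟨c, ⟨h1, h2⟩, rfl⟩

/-- [folklore] `bondsOfCubes` is monotone in the family. -/
theorem bondsOfCubes_mono {W W' : Finset (TPt 4 (R.cubesPerDir k))} (h : W ⊆ W') : bondsOfCubes R k W ⊆ bondsOfCubes R k W' := by
  intro b hb
  obtain ⟨c, rfl, h1, h2⟩ := (mem_bondsOfCubes_iff R).1 hb
  exact (mem_bondsOfCubes_iff R).2 ⟨c, rfl, h h1, h h2⟩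

/-- [folklore] **ROW NE5's `bondsIn` READ TORUS-SIDE**: the bonds inside the scale-`k` domain `domEmb R k Z₀` ARE the level-`k` bonds of its cube
family (`B13InnerData.mem_bondsIn` + `B13CarriersFootprint.mem_sitesAt`). -/
theorem bondsIn_domEmb_eq (Z₀ : TDom 4 (R.cubesPerDir k)) : bondsIn R (domEmb R k Z₀) = bondsOfCubes R k Z₀.1 := by
  ext b
  rw [mem_bondsIn, mem_bondsOfCubes_iff, domEmb_apply]
  constructor
  · rintro ⟨c, rfl, h1, h2⟩
    exact ⟨c, rfl, (mem_sitesAt _ _).1 h1, (mem_sitesAt _ _).1 h2⟩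
  · rintro ⟨c, rfl, h1, h2⟩
    exact ⟨c, rfl, (mem_sitesAt _ _).2 h1, (mem_sitesAt _ _).2 h2⟩

/-- [folklore] **THE COUNT: AT MOST `4·(L^{m′})^4` BONDS PER CUBE** — `#(bondsOfCubes R k W) ≤ 4 · (L^{m′})^4 · #W` on the standing range
`k + m′ ≤ m + K` (a bond is its source site and one of `4` directions; at most `(L^{m′})^4` sites per cube). -/
theorem card_bondsOfCubes_le (hk : k + R.m' ≤ R.F.m + R.K) (W : Finset (TPt 4 (R.cubesPerDir k))) :
    (bondsOfCubes R k W).card ≤ 4 * (R.F.L ^ R.m') ^ 4 * W.card := by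
  classical
  rw [bondsOfCubes, Finset.card_map]
  set S : Finset (Site (R.F.P R.K) k) := Finset.univ.filter fun x => toCube R k k x ∈ W with hS
  calc ((Finset.univ : Finset (PBond (R.F.P R.K) k)).filter fun c => toCube R k k c.src ∈ W ∧ toCube R k k c.tgt ∈ W).card
      ≤ ((Finset.univ : Finset (PBond (R.F.P R.K) k)).filter fun c => toCube R k k c.src ∈ W).card :=
        Finset.card_le_card fun c hc => by
          rw [Finset.mem_filter] at hc ⊢
          exact ⟨hc.1, hc.2.1⟩
    _ ≤ (S ×ˢ (Finset.univ : Finset (Fin (R.F.P R.K).d))).card := by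
        refine Finset.card_le_card_of_injOn (fun c => (c.src, c.dir)) (fun c hc => ?_) (fun c _ c' _ h => ?_)
        · have hc' : toCube R k k c.src ∈ W := by simpa using hc
          rw [Finset.mem_coe, Finset.mem_product]
          exact ⟨Finset.mem_filter.2 ⟨Finset.mem_univ _, hc'⟩, Finset.mem_univ _⟩
        · obtain ⟨s₁, d₁⟩ := c
          obtain ⟨s₂, d₂⟩ := c'
          simp only [Prod.mk.injEq] at h
          rw [h.1, h.2]
    _ = S.card * 4 := by rw [Finset.card_product, Finset.card_univ, T4Family.P_d, Fintype.card_fin]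
    _ ≤ (R.F.L ^ R.m') ^ 4 * W.card * 4 := Nat.mul_le_mul_right 4 (card_filter_toCube_mem_le R hk W)
    _ = 4 * (R.F.L ^ R.m') ^ 4 * W.card := by ring

/-- [folklore] The count in the real currency of the owner's `hb₀` binder: `#(bondsOfCubes R k W) ≤ (4·L^{4m′}) · #W`. -/
theorem card_bondsOfCubes_le_real (hk : k + R.m' ≤ R.F.m + R.K) (W : Finset (TPt 4 (R.cubesPerDir k))) :
    ((bondsOfCubes R k W).card : ℝ) ≤ (4 * (R.F.L : ℝ) ^ (4 * R.m')) * W.card := by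
  have h := card_bondsOfCubes_le R hk W
  have e : ((R.F.L : ℝ) ^ R.m') ^ 4 = (R.F.L : ℝ) ^ (4 * R.m') := by rw [← pow_mul, mul_comm]
  calc ((bondsOfCubes R k W).card : ℝ) ≤ ((4 * (R.F.L ^ R.m') ^ 4 * W.card : ℕ) : ℝ) := by exact_mod_cast h
    _ = (4 * (R.F.L : ℝ) ^ (4 * R.m')) * W.card := by push_cast; rw [e]

end Bonds

/-! ## §4 In the fine-torus currency `TPt 4 (L·N′)`, `N′ := R.cubesPerDir (k+1)` (the owner's `CubeK`) -/

section Fine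

variable {G : Type} [GaugeGroup G] {R : TwoRuns G} {k : ℕ} (hk : k + 1 + R.m' ≤ R.F.m + R.K)

/-- [folklore] **THE LEVEL-`k` BONDS OF A FAMILY OF FINE-TORUS CUBES** (transported by `finePt`): the owner's `bondsOf : Finset CubeK → Finset Bnd`
on the carriers of record, `CubeK := TPt 4 (L·N′)`, `Bnd := Bnd R`. -/
noncomputable def bondsOfFineCubes (W : Finset (TPt 4 (R.F.L * R.cubesPerDir (k + 1)))) : Finset (Bnd R) :=
  bondsOfCubes R k (W.map (finePt hk).toEmbedding)

/-- [folklore] `bondsOfFineCubes` is monotone. -/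
theorem bondsOfFineCubes_mono {W W' : Finset (TPt 4 (R.F.L * R.cubesPerDir (k + 1)))} (h : W ⊆ W') :
    bondsOfFineCubes hk W ⊆ bondsOfFineCubes hk W' :=
  bondsOfCubes_mono R (Finset.map_subset_map.2 h)

/-- [folklore] **ROW NE5's `bondsIn` AT AN EMBEDDED FINE DOMAIN, READ TORUS-SIDE**: `bondsIn R (fineEmb hk Z₀) = bondsOfFineCubes hk Z₀.1` — so the
well-formedness clause `P ⊆ bondsIn R (fineEmb hk Z₀)` of `SubstrateNestedToriOfRecord.mem_torusLabels_iff` reads `P ⊆ bondsOfFineCubes hk Z₀.1`. -/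
theorem bondsIn_fineEmb_eq (Z₀ : TDom 4 (R.F.L * R.cubesPerDir (k + 1))) : bondsIn R (fineEmb hk Z₀) = bondsOfFineCubes hk Z₀.1 := by
  rw [fineEmb_apply, ← domEmb_apply, bondsIn_domEmb_eq, fineDom_val]
  rfl

/-- [folklore] **THE COUNT IN THE FINE-TORUS CURRENCY**: `#(bondsOfFineCubes hk W) ≤ 4 · (L^{m′})^4 · #W`. -/
theorem card_bondsOfFineCubes_le (W : Finset (TPt 4 (R.F.L * R.cubesPerDir (k + 1)))) :
    (bondsOfFineCubes hk W).card ≤ 4 * (R.F.L ^ R.m') ^ 4 * W.card := by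
  have h := card_bondsOfCubes_le R (k := k) (by omega) (W.map (finePt hk).toEmbedding)
  rwa [Finset.card_map] at h

/-- [folklore] **THE OWNER's `hb₀` ON BAŁABAN's LATTICE**: `∀ W, #(bondsOfFineCubes hk W) ≤ b₀ · #W` with `b₀ := 4 · L^{4m′}` (real currency, the
shape of `Spine/NE1p/DressedSmallFieldRecordLabels.count_recordLabels_geometry`'s binder `hb₀`). -/
theorem card_bondsOfFineCubes_le_real (W : Finset (TPt 4 (R.F.L * R.cubesPerDir (k + 1)))) :
    ((bondsOfFineCubes hk W).card : ℝ) ≤ (4 * (R.F.L : ℝ) ^ (4 * R.m')) * W.card := by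
  have h := card_bondsOfCubes_le_real R (k := k) (by omega) (W.map (finePt hk).toEmbedding)
  rwa [Finset.card_map] at h

end Fine

end Summit.QuantumFields.BalabanUV.T4Continuum.SubstrateBondsOfCubes

end
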